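import Mathlib.Tactic

/-!
# Route `KPlusLogSqLaw`, crux `TropicalB` — Toeplitz sector: MORPH THEOREM — the morph involution is TIGHT for the closed-form dual

HONEST FRAMING.  Helper toward the registered stubs `stub_tropThin` / `stub_tropFat` (crux `…Theses.KPlusLogSqLaw.TropicalB`, item
`stmt-ValiantsHypothesis-19771`; cell `pub-symmetroid`, seat `val-sym-trop-p4` (g23), 2026-08-29).  Positions `p ∈ [0, 4q)`, coordinate
`X p` = distance from the centre pair (`2q−1−p` on the left half, `p−2q` on the right half), the morph involution `g` (the member `μ_j`,
`j = 2h+1`, `1 ≤ j ≤ q−1`, given ABSTRACTLY by its ten zone formulas `hgA1 … hgF2` — blocks A | B | C | E | F of the sign string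
`U^q D^{q−j} (UD)^j U^{q−j} D^q`), and the dual potential `f` (five zone formulas `hf1e … hf5`, as in `…ToeplitzMorphFeasible*`).
`morph_tight`: for every `p`, the pair `(p, g p)` is TIGHT — `f(X p) + f(X (g p)) + d(K − 2d) = c` with `d = |g p − p|`, `K = 4q+4h+3`,
`c = T + (2q+2h+1)(q+h+1)` — and `g` is an involution of `[0, 4q)`.  Sixteen zone cases, each a ring identity after rewriting; definition-free;
generated (HOME/val-sym-trop-p4/g23/tools/cert/leantight.py).  Used by `…ToeplitzMorphMember`.  Nothing here bounds `Φ_Toep`;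
`ConjectureTPoly` / `TropicalB` stay OPEN; nothing on `MatrixDescartes` or `VP ≠ VNP`.
-/

set_option linter.dupNamespace false
set_option autoImplicit false

namespace Summit.ValiantsHypothesis.ValiantsHypothesis.Theorems.KPlusLogSqLaw.Toeplitz


set_option maxHeartbeats 1600000 in
/-- **The morph involution is tight and involutive**: for every position `p ∈ [0, 4q)`,
`f(X p) + f(X (g p)) + |g p − p|·(K − 2|g p − p|) = c`, `g p ∈ [0, 4q)` and `g (g p) = p`. [folklore] -/
theorem morph_tight (q h : ℤ) (hq : 2 * h + 2 ≤ q) (hh : 0 ≤ h) (f X g : ℤ → ℤ)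
    (hf1e : ∀ t : ℤ, 0 ≤ t → t ≤ h → f (2 * t) = (4)*t^2)
    (hf1o : ∀ t : ℤ, 0 ≤ t → t + 1 ≤ h → f (2 * t + 1) = (4)*t^2 + (4)*t + (1))
    (hf2 : ∀ x : ℤ, 2 * h + 1 ≤ x → x ≤ q - 1 → f x = (4)*h*x + (-4)*h^2 + (-2)*h + (1)*x)
    (hf3 : ∀ x : ℤ, q ≤ x → x ≤ q + h → f x = (4)*h*x + (-4)*h^2 + (4)*q*x + (-2)*q^2 + (-2)*x^2 + (-2)*h + (2)*q + (-1)*x)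
    (hf4 : ∀ x : ℤ, q + h + 1 ≤ x → x ≤ q + 2 * h + 1 → f x = (4)*h*x + (-4)*h^2 + (4)*q*x + (-2)*q^2 + (-2)*x^2 + (-6)*h + (-2)*q + (3)*x + (-1))
    (hf5 : ∀ x : ℤ, q + 2 * h + 2 ≤ x → x ≤ 2 * q - 1 → f x = (8)*h*q + (-4)*h*x + (4)*h^2 + (2)*h + (2)*q + (-1)*x + (1))
    (hxL : ∀ p : ℤ, 0 ≤ p → p ≤ 2 * q - 1 → X p = 2 * q - 1 - p)
    (hxR : ∀ p : ℤ, 2 * q ≤ p → p ≤ 4 * q - 1 → X p = p - 2 * q)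
    (hgA1 : ∀ p : ℤ, 0 ≤ p → p ≤ q - 2 * h - 2 → g p = p + q)
    (hgA2 : ∀ p : ℤ, q - 2 * h - 2 ≤ p → p ≤ q - 1 → g p = 2 * p + 2 * h + 2)
    (hgB : ∀ p : ℤ, q ≤ p → p ≤ 2 * q - 2 * h - 2 → g p = p - q)
    (hgCe : ∀ s : ℤ, 0 ≤ s → s ≤ h → g (2 * q - 1 - 2 * s) = 3 * q + h - s)
    (hgCo : ∀ s : ℤ, 0 ≤ s → s + 1 ≤ h → g (2 * q - 2 - 2 * s) = q - h - 2 - s)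
    (hgDo : ∀ s : ℤ, 0 ≤ s → s + 1 ≤ h → g (2 * q + 2 * s + 1) = 3 * q + h + 1 + s)
    (hgDe : ∀ s : ℤ, 0 ≤ s → s ≤ h → g (2 * q + 2 * s) = q - h - 1 + s)
    (hgE : ∀ p : ℤ, 2 * q + 2 * h + 1 ≤ p → p ≤ 3 * q - 1 → g p = p + q)
    (hgF1 : ∀ p : ℤ, 3 * q ≤ p → p ≤ 3 * q + 2 * h + 1 → g p = 2 * p - 4 * q - 2 * h - 1)
    (hgF2 : ∀ p : ℤ, 3 * q + 2 * h + 1 ≤ p → p ≤ 4 * q - 1 → g p = p - q)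
    (p : ℤ) (hp0 : 0 ≤ p) (hp1 : p ≤ 4 * q - 1) :
    f (X p) + f (X (g p)) + |g p - p| * ((4 * q + 4 * h + 3) - 2 * |g p - p|) = (8)*h*q + (2)*q^2 + (4)*q + (1) ∧
      0 ≤ g p ∧ g p ≤ 4 * q - 1 ∧ g (g p) = p := by
  rcases lt_or_ge p (2 * q) with hside | hside
  · -- left half
    rcases le_or_gt p (q - 2 * h - 3) with h1 | h1
    · have hgp : g (p) = p + q := hgA1 p (by omega) (by omega)
      have hXp : X (p) = 2 * q - 1 - p := by have hx := hxL (p) (by omega) (by omega); omega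
      have hXg : X (g (p)) = q - 1 - p := by rw [hgp]; have hx := hxL (p + q) (by omega) (by omega); omega
      have hd : |g (p) - (p)| = q := by rw [hgp, abs_of_nonneg (by omega : (0:ℤ) ≤ p + q - (p))]; ring
      have hgg : g (g (p)) = p := by rw [hgp]; have hg2 := hgB (p + q) (by omega) (by omega); omega
      refine ⟨?_, by omega, by omega, hgg⟩
      rw [hXp, hXg, hd, hf5 (2 * q - 1 - p) (by omega) (by omega), hf2 (q - 1 - p) (by omega) (by omega)]
      ring
    · rcases le_or_gt p (q - 2 * h - 2) with h2 | h2
      · have hp : p = q - 2 * h - 2 := by omega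
        have hgp : g (p) = p + q := hgA1 p (by omega) (by omega)
        have hXp : X (p) = q + 2 * h + 1 := by have hx := hxL (p) (by omega) (by omega); omega
        have hXg : X (g (p)) = 2 * h + 1 := by rw [hgp]; have hx := hxL (p + q) (by omega) (by omega); omega
        have hd : |g (p) - (p)| = q := by rw [hgp, abs_of_nonneg (by omega : (0:ℤ) ≤ p + q - (p))]; ring
        have hgg : g (g (p)) = p := by rw [hgp]; have hg2 := hgB (p + q) (by omega) (by omega); omega
        refine ⟨?_, by omega, by omega, hgg⟩
        rw [hXp, hXg, hd, hf4 (q + 2 * h + 1) (by omega) (by omega), hf2 (2 * h + 1) (by omega) (by omega)]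
        ring
      · rcases le_or_gt p (q - h - 2) with h3 | h3
        · obtain ⟨t, rfl⟩ : ∃ t : ℤ, p = q - h - 2 - t := ⟨q - h - 2 - p, by ring⟩
          have hgp : g (q - h - 2 - t) = 2 * q - 2 - 2 * t := by have e := hgA2 (q - h - 2 - t) (by omega) (by omega); omega
          have hXp : X (q - h - 2 - t) = q + h + 1 + t := by have hx := hxL (q - h - 2 - t) (by omega) (by omega); omega
          have hXg : X (g (q - h - 2 - t)) = 2 * t + 1 := by rw [hgp]; have hx := hxL (2 * q - 2 - 2 * t) (by omega) (by omega); omega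
          have hd : |g (q - h - 2 - t) - (q - h - 2 - t)| = q + h - t := by rw [hgp, abs_of_nonneg (by omega : (0:ℤ) ≤ 2 * q - 2 - 2 * t - (q - h - 2 - t))]; ring
          have hgg : g (g (q - h - 2 - t)) = q - h - 2 - t := by rw [hgp]; have hg2 := hgCo t (by omega) (by omega); omega
          refine ⟨?_, by omega, by omega, hgg⟩
          rw [hXp, hXg, hd, hf4 (q + h + 1 + t) (by omega) (by omega), hf1o t (by omega) (by omega)]
          ring
        · rcases le_or_gt p (q - 1) with h4 | h4
          · obtain ⟨s, rfl⟩ : ∃ s : ℤ, p = q - h - 1 + s := ⟨p - q + h + 1, by ring⟩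
            have hgp : g (q - h - 1 + s) = 2 * q + 2 * s := by have e := hgA2 (q - h - 1 + s) (by omega) (by omega); omega
            have hXp : X (q - h - 1 + s) = q + h - s := by have hx := hxL (q - h - 1 + s) (by omega) (by omega); omega
            have hXg : X (g (q - h - 1 + s)) = 2 * s := by rw [hgp]; have hx := hxR (2 * q + 2 * s) (by omega) (by omega); omega
            have hd : |g (q - h - 1 + s) - (q - h - 1 + s)| = q + h + 1 + s := by rw [hgp, abs_of_nonneg (by omega : (0:ℤ) ≤ 2 * q + 2 * s - (q - h - 1 + s))]; ring
            have hgg : g (g (q - h - 1 + s)) = q - h - 1 + s := by rw [hgp]; have hg2 := hgDe s (by omega) (by omega); omega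
            refine ⟨?_, by omega, by omega, hgg⟩
            rw [hXp, hXg, hd, hf3 (q + h - s) (by omega) (by omega), hf1e s (by omega) (by omega)]
            ring
          · rcases le_or_gt p (2 * q - 2 * h - 3) with h5 | h5
            · have hgp : g (p) = p - q := hgB p (by omega) (by omega)
              have hXp : X (p) = 2 * q - 1 - p := by have hx := hxL (p) (by omega) (by omega); omega
              have hXg : X (g (p)) = 3 * q - 1 - p := by rw [hgp]; have hx := hxL (p - q) (by omega) (by omega); omega
              have hd : |g (p) - (p)| = q := by rw [hgp, abs_of_nonpos (by omega : p - q - (p) ≤ 0)]; ring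
              have hgg : g (g (p)) = p := by rw [hgp]; have hg2 := hgA1 (p - q) (by omega) (by omega); omega
              refine ⟨?_, by omega, by omega, hgg⟩
              rw [hXp, hXg, hd, hf2 (2 * q - 1 - p) (by omega) (by omega), hf5 (3 * q - 1 - p) (by omega) (by omega)]
              ring
            · rcases le_or_gt p (2 * q - 2 * h - 2) with h6 | h6
              · have hp : p = 2 * q - 2 * h - 2 := by omega
                have hgp : g (p) = p - q := hgB p (by omega) (by omega)
                have hXp : X (p) = 2 * h + 1 := by have hx := hxL (p) (by omega) (by omega); omega
                have hXg : X (g (p)) = q + 2 * h + 1 := by rw [hgp]; have hx := hxL (p - q) (by omega) (by omega); omega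
                have hd : |g (p) - (p)| = q := by rw [hgp, abs_of_nonpos (by omega : p - q - (p) ≤ 0)]; ring
                have hgg : g (g (p)) = p := by rw [hgp]; have hg2 := hgA1 (p - q) (by omega) (by omega); omega
                refine ⟨?_, by omega, by omega, hgg⟩
                rw [hXp, hXg, hd, hf2 (2 * h + 1) (by omega) (by omega), hf4 (q + 2 * h + 1) (by omega) (by omega)]
                ring
              · -- left centre: parity of the coordinate 2q-1-p
                obtain ⟨s, hs⟩ := Int.even_or_odd' (2 * q - 1 - p)
                rcases hs with hs | hs
                · have hp : p = 2 * q - 1 - 2 * s := by omega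
                  subst hp
                  have hgp : g (2 * q - 1 - 2 * s) = 3 * q + h - s := hgCe s (by omega) (by omega)
                  have hXp : X (2 * q - 1 - 2 * s) = 2 * s := by have hx := hxL (2 * q - 1 - 2 * s) (by omega) (by omega); omega
                  have hXg : X (g (2 * q - 1 - 2 * s)) = q + h - s := by rw [hgp]; have hx := hxR (3 * q + h - s) (by omega) (by omega); omega
                  have hd : |g (2 * q - 1 - 2 * s) - (2 * q - 1 - 2 * s)| = q + h + 1 + s := by rw [hgp, abs_of_nonneg (by omega : (0:ℤ) ≤ 3 * q + h - s - (2 * q - 1 - 2 * s))]; ring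
                  have hgg : g (g (2 * q - 1 - 2 * s)) = 2 * q - 1 - 2 * s := by rw [hgp]; have hg2 := hgF1 (3 * q + h - s) (by omega) (by omega); omega
                  refine ⟨?_, by omega, by omega, hgg⟩
                  rw [hXp, hXg, hd, hf1e s (by omega) (by omega), hf3 (q + h - s) (by omega) (by omega)]
                  ring
                · have hp : p = 2 * q - 2 - 2 * s := by omega
                  subst hp
                  have hgp : g (2 * q - 2 - 2 * s) = q - h - 2 - s := hgCo s (by omega) (by omega)
                  have hXp : X (2 * q - 2 - 2 * s) = 2 * s + 1 := by have hx := hxL (2 * q - 2 - 2 * s) (by omega) (by omega); omega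
                  have hXg : X (g (2 * q - 2 - 2 * s)) = q + h + 1 + s := by rw [hgp]; have hx := hxL (q - h - 2 - s) (by omega) (by omega); omega
                  have hd : |g (2 * q - 2 - 2 * s) - (2 * q - 2 - 2 * s)| = q + h - s := by rw [hgp, abs_of_nonpos (by omega : q - h - 2 - s - (2 * q - 2 - 2 * s) ≤ 0)]; ring
                  have hgg : g (g (2 * q - 2 - 2 * s)) = 2 * q - 2 - 2 * s := by rw [hgp]; have hg2 := hgA2 (q - h - 2 - s) (by omega) (by omega); omega
                  refine ⟨?_, by omega, by omega, hgg⟩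
                  rw [hXp, hXg, hd, hf1o s (by omega) (by omega), hf4 (q + h + 1 + s) (by omega) (by omega)]
                  ring
  · -- right half
    rcases le_or_gt p (2 * q + 2 * h) with h1 | h1
    · obtain ⟨s, hs⟩ := Int.even_or_odd' (p - 2 * q)
      rcases hs with hs | hs
      · have hp : p = 2 * q + 2 * s := by omega
        subst hp
        have hgp : g (2 * q + 2 * s) = q - h - 1 + s := hgDe s (by omega) (by omega)
        have hXp : X (2 * q + 2 * s) = 2 * s := by have hx := hxR (2 * q + 2 * s) (by omega) (by omega); omega
        have hXg : X (g (2 * q + 2 * s)) = q + h - s := by rw [hgp]; have hx := hxL (q - h - 1 + s) (by omega) (by omega); omega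
        have hd : |g (2 * q + 2 * s) - (2 * q + 2 * s)| = q + h + 1 + s := by rw [hgp, abs_of_nonpos (by omega : q - h - 1 + s - (2 * q + 2 * s) ≤ 0)]; ring
        have hgg : g (g (2 * q + 2 * s)) = 2 * q + 2 * s := by rw [hgp]; have hg2 := hgA2 (q - h - 1 + s) (by omega) (by omega); omega
        refine ⟨?_, by omega, by omega, hgg⟩
        rw [hXp, hXg, hd, hf1e s (by omega) (by omega), hf3 (q + h - s) (by omega) (by omega)]
        ring
      · have hp : p = 2 * q + 2 * s + 1 := by omega
        subst hp
        have hgp : g (2 * q + 2 * s + 1) = 3 * q + h + 1 + s := hgDo s (by omega) (by omega)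
        have hXp : X (2 * q + 2 * s + 1) = 2 * s + 1 := by have hx := hxR (2 * q + 2 * s + 1) (by omega) (by omega); omega
        have hXg : X (g (2 * q + 2 * s + 1)) = q + h + 1 + s := by rw [hgp]; have hx := hxR (3 * q + h + 1 + s) (by omega) (by omega); omega
        have hd : |g (2 * q + 2 * s + 1) - (2 * q + 2 * s + 1)| = q + h - s := by rw [hgp, abs_of_nonneg (by omega : (0:ℤ) ≤ 3 * q + h + 1 + s - (2 * q + 2 * s + 1))]; ring
        have hgg : g (g (2 * q + 2 * s + 1)) = 2 * q + 2 * s + 1 := by rw [hgp]; have hg2 := hgF1 (3 * q + h + 1 + s) (by omega) (by omega); omega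
        refine ⟨?_, by omega, by omega, hgg⟩
        rw [hXp, hXg, hd, hf1o s (by omega) (by omega), hf4 (q + h + 1 + s) (by omega) (by omega)]
        ring
    · rcases le_or_gt p (2 * q + 2 * h + 1) with h2 | h2
      · have hp : p = 2 * q + 2 * h + 1 := by omega
        have hgp : g (p) = p + q := hgE p (by omega) (by omega)
        have hXp : X (p) = 2 * h + 1 := by have hx := hxR (p) (by omega) (by omega); omega
        have hXg : X (g (p)) = q + 2 * h + 1 := by rw [hgp]; have hx := hxR (p + q) (by omega) (by omega); omega
        have hd : |g (p) - (p)| = q := by rw [hgp, abs_of_nonneg (by omega : (0:ℤ) ≤ p + q - (p))]; ring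
        have hgg : g (g (p)) = p := by rw [hgp]; have hg2 := hgF2 (p + q) (by omega) (by omega); omega
        refine ⟨?_, by omega, by omega, hgg⟩
        rw [hXp, hXg, hd, hf2 (2 * h + 1) (by omega) (by omega), hf4 (q + 2 * h + 1) (by omega) (by omega)]
        ring
      · rcases le_or_gt p (3 * q - 1) with h3 | h3
        · have hgp : g (p) = p + q := hgE p (by omega) (by omega)
          have hXp : X (p) = p - 2 * q := by have hx := hxR (p) (by omega) (by omega); omega
          have hXg : X (g (p)) = p - q := by rw [hgp]; have hx := hxR (p + q) (by omega) (by omega); omega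
          have hd : |g (p) - (p)| = q := by rw [hgp, abs_of_nonneg (by omega : (0:ℤ) ≤ p + q - (p))]; ring
          have hgg : g (g (p)) = p := by rw [hgp]; have hg2 := hgF2 (p + q) (by omega) (by omega); omega
          refine ⟨?_, by omega, by omega, hgg⟩
          rw [hXp, hXg, hd, hf2 (p - 2 * q) (by omega) (by omega), hf5 (p - q) (by omega) (by omega)]
          ring
        · rcases le_or_gt p (3 * q + h) with h4 | h4
          · obtain ⟨s, rfl⟩ : ∃ s : ℤ, p = 3 * q + h - s := ⟨3 * q + h - p, by ring⟩
            have hgp : g (3 * q + h - s) = 2 * q - 1 - 2 * s := by have e := hgF1 (3 * q + h - s) (by omega) (by omega); omega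
            have hXp : X (3 * q + h - s) = q + h - s := by have hx := hxR (3 * q + h - s) (by omega) (by omega); omega
            have hXg : X (g (3 * q + h - s)) = 2 * s := by rw [hgp]; have hx := hxL (2 * q - 1 - 2 * s) (by omega) (by omega); omega
            have hd : |g (3 * q + h - s) - (3 * q + h - s)| = q + h + 1 + s := by rw [hgp, abs_of_nonpos (by omega : 2 * q - 1 - 2 * s - (3 * q + h - s) ≤ 0)]; ring
            have hgg : g (g (3 * q + h - s)) = 3 * q + h - s := by rw [hgp]; have hg2 := hgCe s (by omega) (by omega); omega
            refine ⟨?_, by omega, by omega, hgg⟩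
            rw [hXp, hXg, hd, hf3 (q + h - s) (by omega) (by omega), hf1e s (by omega) (by omega)]
            ring
          · rcases le_or_gt p (3 * q + 2 * h) with h5 | h5
            · obtain ⟨t, rfl⟩ : ∃ t : ℤ, p = 3 * q + h + 1 + t := ⟨p - 3 * q - h - 1, by ring⟩
              have hgp : g (3 * q + h + 1 + t) = 2 * q + 2 * t + 1 := by have e := hgF1 (3 * q + h + 1 + t) (by omega) (by omega); omega
              have hXp : X (3 * q + h + 1 + t) = q + h + 1 + t := by have hx := hxR (3 * q + h + 1 + t) (by omega) (by omega); omega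
              have hXg : X (g (3 * q + h + 1 + t)) = 2 * t + 1 := by rw [hgp]; have hx := hxR (2 * q + 2 * t + 1) (by omega) (by omega); omega
              have hd : |g (3 * q + h + 1 + t) - (3 * q + h + 1 + t)| = q + h - t := by rw [hgp, abs_of_nonpos (by omega : 2 * q + 2 * t + 1 - (3 * q + h + 1 + t) ≤ 0)]; ring
              have hgg : g (g (3 * q + h + 1 + t)) = 3 * q + h + 1 + t := by rw [hgp]; have hg2 := hgDo t (by omega) (by omega); omega
              refine ⟨?_, by omega, by omega, hgg⟩
              rw [hXp, hXg, hd, hf4 (q + h + 1 + t) (by omega) (by omega), hf1o t (by omega) (by omega)]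
              ring
            · rcases le_or_gt p (3 * q + 2 * h + 1) with h6 | h6
              · have hp : p = 3 * q + 2 * h + 1 := by omega
                have hgp : g (p) = p - q := hgF2 p (by omega) (by omega)
                have hXp : X (p) = q + 2 * h + 1 := by have hx := hxR (p) (by omega) (by omega); omega
                have hXg : X (g (p)) = 2 * h + 1 := by rw [hgp]; have hx := hxR (p - q) (by omega) (by omega); omega
                have hd : |g (p) - (p)| = q := by rw [hgp, abs_of_nonpos (by omega : p - q - (p) ≤ 0)]; ring
                have hgg : g (g (p)) = p := by rw [hgp]; have hg2 := hgE (p - q) (by omega) (by omega); omega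
                refine ⟨?_, by omega, by omega, hgg⟩
                rw [hXp, hXg, hd, hf4 (q + 2 * h + 1) (by omega) (by omega), hf2 (2 * h + 1) (by omega) (by omega)]
                ring
              · have hgp : g (p) = p - q := hgF2 p (by omega) (by omega)
                have hXp : X (p) = p - 2 * q := by have hx := hxR (p) (by omega) (by omega); omega
                have hXg : X (g (p)) = p - 3 * q := by rw [hgp]; have hx := hxR (p - q) (by omega) (by omega); omega
                have hd : |g (p) - (p)| = q := by rw [hgp, abs_of_nonpos (by omega : p - q - (p) ≤ 0)]; ring
                have hgg : g (g (p)) = p := by rw [hgp]; have hg2 := hgE (p - q) (by omega) (by omega); omega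
                refine ⟨?_, by omega, by omega, hgg⟩
                rw [hXp, hXg, hd, hf5 (p - 2 * q) (by omega) (by omega), hf2 (p - 3 * q) (by omega) (by omega)]
                ring

end Summit.ValiantsHypothesis.ValiantsHypothesis.Theorems.KPlusLogSqLaw.Toeplitz
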